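import Summits.CriticalPhenomena.PercolationContinuityZ3.Theorems.PercNearOneGluingNoHeavyQuantBlobWindowVertex
import HarnessLib

/-!
# QUANT lane R8 tool: VERTEX REDUCTION for the FAR EXCHANGE FUNCTIONAL of a block-comb —
# FAR on a block-comb is affine in every private gate, so for fixed chain weights it need only be proved when every blob is
# TIED (gate at its floor `ℓ k = x / w k`, marginal `= x`) or GLUED (gate `1`, relays on the chain)

builds on p205010 (kernel theorem, internal audit signed; external expert review pending)

Support file (`--supports stmt-CriticalPhenomena-4575`), QUANT lane lead (gen 11), rung R8 of
`run/shared/lean/prim/quant/LADDER.md`; paper `run/shared/lean/prim/quant/prim-quant-lead-g11/LEAD-NOTES-G11.md` N22 (2).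
Pure real algebra on the explicit cdf recursion `CB[a, p, m]` of `…QuantBlobWalk.lean` (lead g10); no probability space,
no definitions (`local notation3` only), no sorries, standard axioms.  Companion of `…QuantBlobWindowVertex.lean` (N22 (1):
the same reduction for the window functionals (TW)/(PW) — which are themselves FALSE as stated, postcont-1 g38 2026-08-20T22:04Z,
lane README V134: the sandwich behind them charges 'phantom dangers' at near-sure blobs, which FAR does not).

**Setting.**  By `Quant.blockComb_exchange_identity` (`…QuantBlockCombCount.lean`, typer g14; N21 (1) of lead g10) the far-relay row
at layer `j` for a block-comb with blob sizes `a k`, private gates `p k`, chain weights `w k` and least marginal `x` (terminal block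
`c`) is EXACTLY the nonnegativity of the EXCHANGE FUNCTIONAL
`EX(p) := Σ_{k<K} (w k − x) · p k · (CB[a,p,k] j − CB[a,p,k] (j − a k)) − x · CB[a,p,K] (j − c)`.
* `exchange_affine` — `EX` is AFFINE in each gate `p i`:  `EX(p[i ↦ y]) = EX(p[i ↦ 0]) + y · (EX(p[i ↦ 1]) − EX(p[i ↦ 0]))`
  (from `BlobWalk.CB_affine`: the coordinate `i` enters the windows of later blobs linearly and its own term as the factor `p i`).
* `exchange_nonneg_of_endpoints` — on a segment `ℓ ≤ y ≤ 1` an affine function is minimised at an endpoint.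
* `exchange_of_vertices` — **VERTEX REDUCTION:** for floors `ℓ : ℕ → ℝ`, if `EX(q) ≥ 0` for every gate vector `q` with
  `q k ∈ {ℓ k, 1}` (`k < K`), then `EX(p) ≥ 0` for every `p` with `ℓ k ≤ p k ≤ 1` (`k < K`); `exchange_le_of_vertices` is the same in
  the `x · CB[K](j − c) ≤ Σ …` shape of `BlobWalk.exchange_of_prefixWindow` / `exchange_of_const'`.
For a block-comb the floors are `ℓ k = x / w k` (the argmin constraint `w k · p k ≥ x`): a blob at its floor is TIED (its relays are
least likely too), a blob at `1` is GLUED (relays on the chain).  The expected count `EN = Σ w k a k p k + c x` increases with every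
gate, so if the ALL-TIED corner has `EN = (A + c) x > 2j` then every vertex has `EN > 2j`: **FAR at layer `j` for every block-comb with
`(A + c)·x > 2j` (N21 (4)'s class, 'as if every relay were least likely') follows from FAR for the tied-or-glued gate patterns on the
same chain** — an iid-per-height walk with interleaved sure blobs, in which (exact form, no sandwich) a glued blob carries the crossing
credit `(w k − x)` of its height and NO danger debit (N22 (2)–(3); census `bcv.py` / kit).  Lead g10's variational normal form N21 (7)
is the minimiser version of the same affinity.  [this work] unless marked [folklore].
-/

noncomputable section

namespace Summit.CriticalPhenomena.PercolationContinuityZ3.Theorems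

namespace Quant

namespace BlobWalk

open Finset

/-- `CB[a, p, m] t` = probability that the open mass of the first `m` blobs (sizes `a`, gates `p`) is `≤ t` (the recursion of `…QuantBlobWalk`). -/
local notation3 "CB[" a ", " p ", " m "]" =>
  (Nat.rec (motive := fun _ => ℤ → ℝ) (fun t => if (0 : ℤ) ≤ t then (1 : ℝ) else 0)
    (fun n f t => (p : ℕ → ℝ) n * f (t - ((a : ℕ → ℕ) n : ℤ)) + (1 - (p : ℕ → ℝ) n) * f t) (m : ℕ))

/-- The FAR exchange functional of a block-comb at layer `j`:
`EX[a, p, K, j, c, w, x] = Σ_{k<K} (w k − x) · p k · (CB[a,p,k] j − CB[a,p,k] (j − a k)) − x · CB[a,p,K] (j − c)`. -/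
local notation3 "EX[" a ", " p ", " K ", " j ", " c ", " w ", " x "]" =>
  ((∑ k ∈ Finset.range (K : ℕ),
      ((w : ℕ → ℝ) k - (x : ℝ)) * (p : ℕ → ℝ) k *
        ((Nat.rec (motive := fun _ => ℤ → ℝ) (fun t => if (0 : ℤ) ≤ t then (1 : ℝ) else 0)
            (fun n f t => (p : ℕ → ℝ) n * f (t - ((a : ℕ → ℕ) n : ℤ)) + (1 - (p : ℕ → ℝ) n) * f t) k) (j : ℤ) -
          (Nat.rec (motive := fun _ => ℤ → ℝ) (fun t => if (0 : ℤ) ≤ t then (1 : ℝ) else 0)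
            (fun n f t => (p : ℕ → ℝ) n * f (t - ((a : ℕ → ℕ) n : ℤ)) + (1 - (p : ℕ → ℝ) n) * f t) k)
            ((j : ℤ) - ((a : ℕ → ℕ) k : ℤ)))) -
    (x : ℝ) *
      (Nat.rec (motive := fun _ => ℤ → ℝ) (fun t => if (0 : ℤ) ≤ t then (1 : ℝ) else 0)
        (fun n f t => (p : ℕ → ℝ) n * f (t - ((a : ℕ → ℕ) n : ℤ)) + (1 - (p : ℕ → ℝ) n) * f t) (K : ℕ))
        ((j : ℤ) - ((c : ℕ) : ℤ)))

variable (a : ℕ → ℕ)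

/-! ### Affinity of the exchange functional in every gate -/

/-- One summand of `EX` is affine in the gate `p i`:
`(w k − x) · p[i↦y] k · window_k(p[i↦y])` interpolates linearly between `y = 0` and `y = 1`. [this work] -/
theorem exchange_term_affine (p : ℕ → ℝ) (i : ℕ) (y : ℝ) (j : ℤ) (w : ℕ → ℝ) (x : ℝ) (k : ℕ) :
    (w k - x) * Function.update p i y k *
        (CB[a, Function.update p i y, k] j - CB[a, Function.update p i y, k] (j - (a k : ℤ))) =
      (w k - x) * Function.update p i 0 k *
          (CB[a, Function.update p i 0, k] j - CB[a, Function.update p i 0, k] (j - (a k : ℤ))) +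
        y * ((w k - x) * Function.update p i 1 k *
              (CB[a, Function.update p i 1, k] j - CB[a, Function.update p i 1, k] (j - (a k : ℤ))) -
            (w k - x) * Function.update p i 0 k *
              (CB[a, Function.update p i 0, k] j - CB[a, Function.update p i 0, k] (j - (a k : ℤ)))) := by
  by_cases hki : k = i
  · subst hki
    -- the windows of blob `k` do not involve the gate `p k`
    have h0 : ∀ s : ℤ, CB[a, Function.update p k y, k] s = CB[a, Function.update p k 0, k] s :=
      CB_congr a _ _ k fun m hm => by
        rw [Function.update_of_ne (Nat.ne_of_lt hm), Function.update_of_ne (Nat.ne_of_lt hm)]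
    have h1 : ∀ s : ℤ, CB[a, Function.update p k 1, k] s = CB[a, Function.update p k 0, k] s :=
      CB_congr a _ _ k fun m hm => by
        rw [Function.update_of_ne (Nat.ne_of_lt hm), Function.update_of_ne (Nat.ne_of_lt hm)]
    rw [h0, h0, h1, h1, Function.update_self, Function.update_self, Function.update_self]
    ring
  · rw [Function.update_of_ne hki, Function.update_of_ne hki, Function.update_of_ne hki,
      CB_affine a p i y k j, CB_affine a p i y k (j - (a k : ℤ))]
    ring

/-- **Affinity of the exchange functional** in every gate: `EX(p[i ↦ y]) = EX(p[i ↦ 0]) + y · (EX(p[i ↦ 1]) − EX(p[i ↦ 0]))`.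
[this work] -/
theorem exchange_affine (p : ℕ → ℝ) (i : ℕ) (y : ℝ) (K : ℕ) (j : ℤ) (c : ℕ) (w : ℕ → ℝ) (x : ℝ) :
    EX[a, Function.update p i y, K, j, c, w, x] =
      EX[a, Function.update p i 0, K, j, c, w, x] +
        y * (EX[a, Function.update p i 1, K, j, c, w, x] - EX[a, Function.update p i 0, K, j, c, w, x]) := by
  have hsum : (∑ k ∈ Finset.range K, (w k - x) * Function.update p i y k *
        (CB[a, Function.update p i y, k] j - CB[a, Function.update p i y, k] (j - (a k : ℤ)))) =
      (∑ k ∈ Finset.range K, (w k - x) * Function.update p i 0 k *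
          (CB[a, Function.update p i 0, k] j - CB[a, Function.update p i 0, k] (j - (a k : ℤ)))) +
        y * ((∑ k ∈ Finset.range K, (w k - x) * Function.update p i 1 k *
              (CB[a, Function.update p i 1, k] j - CB[a, Function.update p i 1, k] (j - (a k : ℤ)))) -
            ∑ k ∈ Finset.range K, (w k - x) * Function.update p i 0 k *
              (CB[a, Function.update p i 0, k] j - CB[a, Function.update p i 0, k] (j - (a k : ℤ)))) := by
    rw [← Finset.sum_sub_distrib, Finset.mul_sum, ← Finset.sum_add_distrib]
    exact Finset.sum_congr rfl fun k _ => exchange_term_affine a p i y j w x k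
  rw [hsum, CB_affine a p i y K (j - (c : ℤ))]
  ring

/-- **One-coordinate step.**  If `EX ≥ 0` at `p[i ↦ ℓ]` and at `p[i ↦ 1]`, then `EX ≥ 0` at `p[i ↦ y]` for every `y ∈ [ℓ, 1]`. [this work] -/
theorem exchange_nonneg_of_endpoints (p : ℕ → ℝ) (i : ℕ) (ℓ y : ℝ) (hly : ℓ ≤ y) (hy1 : y ≤ 1)
    (K : ℕ) (j : ℤ) (c : ℕ) (w : ℕ → ℝ) (x : ℝ)
    (hℓ : 0 ≤ EX[a, Function.update p i ℓ, K, j, c, w, x]) (h1 : 0 ≤ EX[a, Function.update p i 1, K, j, c, w, x]) :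
    0 ≤ EX[a, Function.update p i y, K, j, c, w, x] := by
  rw [exchange_affine a p i y K j c w x]
  rw [exchange_affine a p i ℓ K j c w x] at hℓ
  set F0 := EX[a, Function.update p i 0, K, j, c, w, x]
  set F1 := EX[a, Function.update p i 1, K, j, c, w, x]
  by_cases hD : 0 ≤ F1 - F0
  · nlinarith [mul_le_mul_of_nonneg_right hly hD]
  · have hD' : F1 - F0 ≤ 0 := le_of_lt (not_le.1 hD)
    nlinarith [mul_le_mul_of_nonpos_right hy1 hD']

/-! ### The vertex reduction -/

/-- **VERTEX REDUCTION for the FAR exchange functional.**  Fix sizes `a`, `K`, layer `j`, terminal block `c`, chain weights `w`, least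
marginal `x` and floors `ℓ : ℕ → ℝ` (for a block-comb, `ℓ k = x / w k`).  If `EX(q) ≥ 0` for every gate vector `q` with
`q k ∈ {ℓ k, 1}` for all `k < K` (every blob TIED or GLUED), then `EX(p) ≥ 0` for every `p` with `ℓ k ≤ p k ≤ 1` for all `k < K`.
(Induction on the number of coordinates `k < K` with `p k ∉ {ℓ k, 1}`.) [this work] -/
theorem exchange_of_vertices (ℓ : ℕ → ℝ) (K : ℕ) (j : ℤ) (c : ℕ) (w : ℕ → ℝ) (x : ℝ)
    (hV : ∀ q : ℕ → ℝ, (∀ k, k < K → q k = ℓ k ∨ q k = 1) → 0 ≤ EX[a, q, K, j, c, w, x])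
    (p : ℕ → ℝ) (hp : ∀ k, k < K → ℓ k ≤ p k ∧ p k ≤ 1) : 0 ≤ EX[a, p, K, j, c, w, x] := by
  suffices H : ∀ n : ℕ, ∀ p : ℕ → ℝ, (∀ k, k < K → ℓ k ≤ p k ∧ p k ≤ 1) →
      ((Finset.range K).filter (fun k => p k ≠ ℓ k ∧ p k ≠ 1)).card = n → 0 ≤ EX[a, p, K, j, c, w, x] from
    H _ p hp rfl
  intro n
  induction n with
  | zero =>
    intro p hp hcard
    refine hV p fun k hk => ?_
    have hk' : k ∉ (Finset.range K).filter (fun k => p k ≠ ℓ k ∧ p k ≠ 1) := by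
      rw [Finset.card_eq_zero] at hcard
      rw [hcard]; exact Finset.notMem_empty k
    rw [Finset.mem_filter, Finset.mem_range, not_and] at hk'
    have := hk' hk
    by_cases h1 : p k = ℓ k
    · exact Or.inl h1
    · exact Or.inr (by by_contra h2; exact this ⟨h1, h2⟩)
  | succ n ih =>
    intro p hp hcard
    have hne : ((Finset.range K).filter (fun k => p k ≠ ℓ k ∧ p k ≠ 1)).Nonempty := by
      rw [← Finset.card_pos, hcard]; exact Nat.succ_pos n
    obtain ⟨i, hi⟩ := hne
    rw [Finset.mem_filter, Finset.mem_range] at hi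
    obtain ⟨hiK, hil, hi1⟩ := hi
    have hcard' : ∀ v : ℝ, (v = ℓ i ∨ v = 1) →
        ((Finset.range K).filter (fun k => Function.update p i v k ≠ ℓ k ∧ Function.update p i v k ≠ 1)).card = n := by
      intro v hv
      have hset : (Finset.range K).filter (fun k => Function.update p i v k ≠ ℓ k ∧ Function.update p i v k ≠ 1) =
          ((Finset.range K).filter (fun k => p k ≠ ℓ k ∧ p k ≠ 1)).erase i := by
        ext k
        rw [Finset.mem_erase, Finset.mem_filter, Finset.mem_filter, Finset.mem_range]
        constructor
        · rintro ⟨hkK, hk⟩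
          have hki : k ≠ i := by
            rintro rfl
            rw [Function.update_self] at hk
            rcases hv with hv | hv
            · exact hk.1 hv
            · exact hk.2 hv
          rw [Function.update_of_ne hki] at hk
          exact ⟨hki, hkK, hk⟩
        · rintro ⟨hki, hkK, hk⟩
          refine ⟨hkK, ?_⟩
          rw [Function.update_of_ne hki]
          exact hk
      rw [hset, Finset.card_erase_of_mem (by rw [Finset.mem_filter, Finset.mem_range]; exact ⟨hiK, hil, hi1⟩), hcard]
      rfl
    have hp' : ∀ v : ℝ, (v = ℓ i ∨ v = 1) → ∀ k, k < K → ℓ k ≤ Function.update p i v k ∧ Function.update p i v k ≤ 1 := by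
      intro v hv k hk
      by_cases hki : k = i
      · subst hki
        rw [Function.update_self]
        rcases hv with hv | hv
        · rw [hv]; exact ⟨le_rfl, (hp k hk).1.trans (hp k hk).2⟩
        · rw [hv]; exact ⟨(hp k hk).1.trans (hp k hk).2, le_rfl⟩
      · rw [Function.update_of_ne hki]; exact hp k hk
    have hl := ih (Function.update p i (ℓ i)) (hp' (ℓ i) (Or.inl rfl)) (hcard' (ℓ i) (Or.inl rfl))
    have h1 := ih (Function.update p i 1) (hp' 1 (Or.inr rfl)) (hcard' 1 (Or.inr rfl))
    have hmain := exchange_nonneg_of_endpoints a p i (ℓ i) (p i) (hp i hiK).1 (hp i hiK).2 K j c w x hl h1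
    rwa [Function.update_eq_self] at hmain

/-- **FAR exchange inequality from the tied-or-glued patterns** (the form used on block-combs): if
`x · CB[q, K](j − c) ≤ Σ_{k<K} (w k − x) · q k · window_k(q)` for every gate vector `q` with `q k ∈ {ℓ k, 1}` (`k < K`), then the same
holds for every `p` with `ℓ k ≤ p k ≤ 1` (`k < K`). [this work] -/
theorem exchange_le_of_vertices (ℓ : ℕ → ℝ) (K : ℕ) (j : ℤ) (c : ℕ) (w : ℕ → ℝ) (x : ℝ)
    (hV : ∀ q : ℕ → ℝ, (∀ k, k < K → q k = ℓ k ∨ q k = 1) →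
      x * CB[a, q, K] (j - (c : ℤ)) ≤ ∑ k ∈ Finset.range K, (w k - x) * q k * (CB[a, q, k] j - CB[a, q, k] (j - (a k : ℤ))))
    (p : ℕ → ℝ) (hp : ∀ k, k < K → ℓ k ≤ p k ∧ p k ≤ 1) :
    x * CB[a, p, K] (j - (c : ℤ)) ≤ ∑ k ∈ Finset.range K, (w k - x) * p k * (CB[a, p, k] j - CB[a, p, k] (j - (a k : ℤ))) := by
  rw [← sub_nonneg]
  exact exchange_of_vertices a ℓ K j c w x (fun q hq => sub_nonneg.2 (hV q hq)) p hp

end BlobWalk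

end Quant

end Summit.CriticalPhenomena.PercolationContinuityZ3.Theorems
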